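import Literature.Computability.Complexity.MoebiusBoundedDepth
import Literature.NumberTheory.Sieve.MoebiusWalshCircuitsProofs
import HarnessLib

/-!
# Bourgain 2013, Theorem 1 for `μ` / `λ`: the `Computability` renderings versus the `NumberTheory` facts (proved bridges)

Topic `Literature/Computability/Complexity`. Everything in this file is PROVED (theorems only); no
definition, no named fact. It is the Bourgain half of the proofs companion of
`MoebiusBoundedDepth.lean` (the Green half — Theorem 1 / Proposition 1 of Green 2012 versus the
`LFunctions` copies — is the sibling `MoebiusBoundedDepthProofs.lean`).

J. Bourgain, J. Anal. Math. 119 (2013), Theorem 1 ("for `λ` large enough,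
`max_A |∑_{n<2^λ} μ(n) w_A(n)| < 2^{λ−λ^{1/10}}` (a similar estimate is also valid for the
Liouville function)") lives in the tree as the named facts

* `Literature.NumberTheory.Sieve.bourgain_moebius_walsh`, `…bourgain_liouville_walsh`
  (`Sieve/MoebiusWalshCircuits.lean`: `∑_{N ∈ range (2^n)}` read through `Nat.testBit`,
  `∀ᶠ n in atTop`; for `λ` the saving exponent is left free, `∃ c > 0`, and `≤`);
* `Literature.NumberTheory.LFunctions.bourgain_moebius_walsh_uniform`,
  `…bourgain_liouville_walsh_uniform` (cube sum `walshSum`, `∃ n₀ ∀ n ≥ n₀`, exponent `1/10` and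
  `<` for both `μ` and `λ`) — the vocabulary of the tree's proof programme for Theorem 1
  (`LFunctions/MoebiusWalshAssembly.lean`: `bourgain_moebius_walsh_uniform_of_typeII`, …);
* and, in this topic, only the `λ` form `Bourgain2013_liouville_walsh` (`MoebiusBoundedDepth.lean`:
  exponent free, strict `<`), which grounds route items. The `μ` statement is NOT re-vendored in
  this topic (it would be the `Sieve` fact verbatim — lean/CONVENTIONS.md §4, no restatement of an
  existing Literature def); its rendering in this topic's conventions is displayed, as a proved
  conditional theorem, in `Bourgain2013_moebius_walsh_of_uniform` below.

We prove

* `Bourgain2013_moebius_walsh_of_uniform`: the `LFunctions` fact for `μ` gives, in this topic's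
  rendering, `∀ᶠ m, ∀ A : Finset (Fin m), |∑_{N < 2^m} μ(N) · walsh A (j ↦ N.testBit j)| < 2^{m − m^{1/10}}`
  (through the `Sieve` topic's proved `bourgain_moebius_walsh_iff_uniform`; the displayed
  conclusion is literally `Literature.NumberTheory.Sieve.bourgain_moebius_walsh`);
* `Bourgain2013_liouville_walsh_iff_sieve`: `<` versus `≤` — halve the exponent, since
  `2^{n − n^c} < 2^{n − n^{c/2}}` for `n ≥ 2` (`two_rpow_sub_rpow_lt_of_one_lt`);
* `Bourgain2013_liouville_walsh_of_uniform`: the `LFunctions` copy (exponent `1/10`) implies this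
  topic's, with `c = 1/10` (the converse is not claimed);

so that this topic's Bourgain fact is discharged the moment a `NumberTheory` twin is
(`Bourgain2013_liouville_walsh_holds := Bourgain2013_liouville_walsh_iff_sieve.2 ‹_›`, or
`:= Bourgain2013_liouville_walsh_of_uniform ‹_›`).

What is NOT here: no discharge. Bourgain's proof needs Green 2012, Proposition 1 (tree, proved:
`Literature.Computability.Complexity.green_moebius_fourierWalsh_holds`; for `λ` the named fact
`Literature.NumberTheory.LFunctions.green_liouville_fourierWalsh`) for `|A| ≤ √n/H`, and the
Mauduit–Rivat type I/II analysis of Bourgain 2013, §§1–3 for `|A| > √n/H`, whose type-II box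
estimate (§2 (2.29)) is the one input of `bourgain_moebius_walsh_uniform_of_typeII` not yet in the
tree at the time of writing.

## References

* J. Bourgain, *Möbius–Walsh correlation bounds and an estimate of Mauduit and Rivat*,
  J. Anal. Math. 119 (2013) 147–163 (arXiv:1109.2784), Theorem 1 and (0.3). [Bourgain2013MoebiusWalsh]
-/

namespace Literature.Computability.Complexity

open Filter Finset
open Literature.Probability.RandomGraphs.LowDegree (walsh sgn)

/-- **Bourgain 2013, Theorem 1 for `μ`, in this topic's rendering, from the `LFunctions` fact.**
"For `λ` large enough, `max_{A ⊆ {0,…,λ-1}} |∑_{n < 2^λ} μ(n) w_A(n)| < 2^{λ - λ^{1/10}}`",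
`w_A(x) = ∏_{j∈A} (1 - 2x_j)`, `x = ∑_{0 ≤ j < λ} x_j 2^j` ((0.1), (0.3)): given the named fact
`Literature.NumberTheory.LFunctions.bourgain_moebius_walsh_uniform` (cube sum `walshSum`,
`∃ n₀ ∀ n ≥ n₀`), eventually in `m` (Bourgain's `λ`), for every `A : Finset (Fin m)`,
`|∑_{N < 2^m} μ(N) · walsh A (j ↦ N.testBit j)| < 2 ^ (m - m^{1/10})` (real exponent). The
conclusion is verbatim the named fact `Literature.NumberTheory.Sieve.bourgain_moebius_walsh`, and
the proof is that topic's `bourgain_moebius_walsh_iff_uniform` (binary expansion is a bijection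
`{0,1}^m ≃ [0, 2^m)`). [cite: Bourgain2013MoebiusWalsh, Theorem 1] -/
theorem Bourgain2013_moebius_walsh_of_uniform
    (h : Literature.NumberTheory.LFunctions.bourgain_moebius_walsh_uniform) :
    ∀ᶠ m : ℕ in Filter.atTop, ∀ A : Finset (Fin m),
      |∑ N ∈ Finset.range (2 ^ m),
          (ArithmeticFunction.moebius N : ℝ) * walsh A (fun j : Fin m => Nat.testBit N j)|
        < (2 : ℝ) ^ ((m : ℝ) - (m : ℝ) ^ ((1 : ℝ) / 10)) :=
  Literature.NumberTheory.Sieve.bourgain_moebius_walsh_iff_uniform.2 h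

/-- `2^{n − n^c} < 2^{n − n^{c/2}}` for real `n > 1` and `c > 0`. [folklore] -/
theorem two_rpow_sub_rpow_lt_of_one_lt {n c : ℝ} (hn : 1 < n) (hc : 0 < c) :
    (2 : ℝ) ^ (n - n ^ c) < (2 : ℝ) ^ (n - n ^ (c / 2)) := by
  have h : n ^ (c / 2) < n ^ c := Real.rpow_lt_rpow_of_exponent_lt hn (by linarith)
  exact Real.rpow_lt_rpow_of_exponent_lt (by norm_num) (by linarith)

/-- **Dedup bridge (Bourgain, `λ`).** This topic's `Bourgain2013_liouville_walsh` (strict `<`) is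
equivalent to `Literature.NumberTheory.Sieve.bourgain_liouville_walsh` (`≤`): both leave the
saving exponent free, and `2^{n − n^c} < 2^{n − n^{c/2}}` for `n ≥ 2` trades `≤` with exponent
`c` for `<` with exponent `c/2`. [cite: Bourgain2013MoebiusWalsh, Theorem 1 (Liouville remark)] -/
theorem Bourgain2013_liouville_walsh_iff_sieve :
    Bourgain2013_liouville_walsh ↔ Literature.NumberTheory.Sieve.bourgain_liouville_walsh := by
  constructor
  · rintro ⟨c, hc, h⟩
    exact ⟨c, hc, h.mono fun n hn A => (hn A).le⟩
  · rintro ⟨c, hc, h⟩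
    refine ⟨c / 2, half_pos hc, ?_⟩
    filter_upwards [h, eventually_gt_atTop 1] with n hn hn1 A
    exact (hn A).trans_lt (two_rpow_sub_rpow_lt_of_one_lt (by exact_mod_cast hn1) hc)

/-- **Dedup bridge (Bourgain, `λ`).** The `LFunctions` form
`Literature.NumberTheory.LFunctions.bourgain_liouville_walsh_uniform` (exponent `1/10`, cube sum)
implies this topic's `Bourgain2013_liouville_walsh`, with `c = 1/10`. The converse is not claimed
(this topic records the exponent-free reading of "a similar estimate is also valid for the
Liouville function"). [cite: Bourgain2013MoebiusWalsh, Theorem 1 (Liouville remark)] -/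
theorem Bourgain2013_liouville_walsh_of_uniform
    (h : Literature.NumberTheory.LFunctions.bourgain_liouville_walsh_uniform) :
    Bourgain2013_liouville_walsh := by
  obtain ⟨n₀, hn₀⟩ := h
  refine ⟨1 / 10, by norm_num, eventually_atTop.mpr ⟨n₀, fun n hn A => ?_⟩⟩
  have := hn₀ n hn A
  rwa [Literature.NumberTheory.Sieve.MoebiusWalsh.walshSum_eq_sum_range] at this

end Literature.Computability.Complexity
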